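import Literature.MathematicalPhysics.QuantumFieldTheory.Balaban1983to89.B15Claim189PinsOfHistory

/-!
# `Balaban1983to89.B15Claim189CubePin` — YM-DAG node N12 · [Balaban1989LargeFieldI] CMP **122** (1989) 175–202, (1.88)–(1.90) p. 198 with [Balaban1988Convergent] (2.17) p. 257:
# THE (1.88) CUBE DATA OF THE (1.89) SITUATION PINNED to def-R's cube partition of record — the cube family of `χ_{h,1/2}` := the cubes MEETING the half domain
# `(Ω″^∼_{h+1})ᶜ ∩ Ω_h`, the cube of a plaquette := the cube of its corner in the half domain — and THE LOCATED INPUT `hbox` («every plaquette of the half domain lies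
# inside `□^∼` for a cube `□` of the family») DISCHARGED as a lattice theorem on the torus

statement-level bookkeeping over published theorems with citation tags; kernel-checked compositions of tree theorems; nothing here is a claim about the Yang–Mills
mass gap.

CITATION HEADER (lean-in-tree rule).  Source: [Balaban1989LargeFieldI] («[IV]») p. 198, verbatim: *"Therefore the above characteristic function is defined by the product over cubes
□ intersecting the domain (Ω″^∼_{h+1})ᶜ and contained in Ω_h"*; *"Take a cube □ ⊂ (Ω″^∼_{h+1})ᶜ ∩ Ω_h, and represent the functions U″_{k,Z} on □^∼ in the usual way: … (1.90)"*;
p. 197: *"subsets P of a component of the domain (Ω″^∼_{h+1})ᶜ which are unions of LM₂R_h-cubes"*; [Balaban1988Convergent] («[III]») (2.17) p. 257 (the `LM₂R_k`-cube partition and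
`□^∼`); for §5–§6 also [IV] (1.79)–(1.80) p. 195 (*«exp(−δ dist(p, Λ))»*), [15] = [Balaban1985Variational] (190) p. 308 (the decay in block units), [Balaban1985RegularSpaces] p. 77 and
[Balaban1985Averaging] (5) p. 18 (plaquette conventions), [Balaban1987RG1] (0.1) p. 251 (the torus).  Seat `pub-ymgap-dag-n12-e` (YM-PLAN Track A, HUMAN RULING D-0062; director-ym R134 row N12 s3 «the
(1.80)∕(1.89) + 𝐑′ (1.99)–(1.100) p. 201 chain»), generation 5, module 15.
BY NAME and UNCHANGED: def-R's `Node00.SmallFieldChiOfRecord` (`cubeIndices`, `cubeEnl`, `plaqInside`), r12's `B14DomainGeom` (`Pt`, `cubeIdx`, `cubeIdx_le`), `B14.Eq213MaximalDomains`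
(`cubeExt`), `B15Eq112TorusCover` (`cover`, `lift`, `cover_lift`, `cover_eq_cover_iff`, `cover_add_pmul`), `B8Eq17ClassAkV1.plaqsOf`, `Setup`'s `Site.tdist`, module 8 `B15Ineq180PinAtRecord` (`U0OfRecord`), p29's `B15Claim189Assembly` (`Setting189`, `half`,
the input `hbox` of `claim189_assembly_of_flow`), module 4 (`Node00.Sit189`), module 14 `B15Claim189PinsOfHistory` (`D189OfHist`, `sitOfHist`, `Sit189.pinLevels`, `claim189_sitOfHist_of_flow ∕
_N0Z_of_flow`), module 13 (`Sit189.pinZpp`).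

WHY THIS FILE.  Among the inputs of the (1.89) display that g0–g4 and module 14 left DISPLAYED is the located geometric input `hbox` of p29's assembly: *every plaquette touching the half domain
`(Ω″^∼_{h+1})ᶜ ∩ Ω_h` has its cube `boxOf p` in the family `halfcubes` of `χ_{h,1/2}` and lies INSIDE `plaqT (boxOf p) = □^∼`* — residual because the situation's cube data `Xhalf`,
`boxOf` were letters (module 4's located note (iii): «the families are def-R's `cubeEnl ∕ plaqInside` at the stated sides»).  Print fixes both (p. 198, quoted above).  HERE they are PINNED to
def-R's objects: over a site set `S` (the half domain), `Xhalf := {a ∈ cubeIndices (F.P K) σ.sh | □_a ∩ S ≠ ∅}` and `boxOf p :=` the `σ.sh`-cube of a corner of `p` lying in `S` — and `hbox` becomes a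
LATTICE THEOREM on the torus `T_η = ℤᵈ ∕ 2L^{m+K}ℤᵈ`: the four corners of a plaquette are deck translates of the corner's lift shifted by at most one step coordinatewise, hence lie in the
one-layer (`σ.sh ≥ 1` sites) collar of the corner's cube (`cubeExt`), whose image under the cover is `cubeEnl … 1 = □^∼`.

* §1 LATTICE (generic `P : Params`): `cubeOfSite s c := cubeIdx s (lift c)`; `lift_lt_mul_cubeIdx_add`, `mem_cubeExt_cubeIdx_of_near`, `cover_add_single` (`π(x + e_μ) = π(x).shift μ`),
  `corners_eq_cover`, `plaq_mem_plaqInside_cubeEnl_src`, `cubeOfSite_mem_cubeIndices`, `mem_cubeEnl_cubeOfSite`, ★ `plaq_mem_plaqInside_cubeEnl_of_corner` (ANY corner's cube works).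
* §2 THE PIN: `plaqCornerIn S p` (+ `plaqCornerIn_isCorner`, `plaqCornerIn_mem`), **`Node00.Sit189.pinCubes σ S`** (+ faces `pinCubes_Xhalf_boxOf ∕ _kept`, commutation with the term ∕ levels ∕ `Z″` ∕ χ′ ∕ `dev0`
  pins `pinCubes_comm`, all `rfl`).
* §3 ★★ **`hbox_D189OfHist_pinCubes`** (at `σ.pinCubes ((Ω″^∼_{h+1})ᶜ ∩ Ω_h)`, `0 < σ.sh`: the input `hbox` HOLDS) and ★★ **`hbox_sitOfHist_pinCubes`** (the same at the term's fully pinned situation,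
  half domain `σ.OmTᶜ ∩ omegaOfChain s (k′ − N)`).
* §4 the (1.89) display with `hbox` DISCHARGED: ★ `claim189_sitOfHist_cubes_of_flow` and ★ `claim189_sitOfHist_cubes_N0Z_of_flow` (`hZk` AND `hbox` discharged — of the located geometry only
  the shell bound `4(m − k₀)M ≤ dist(p, Λ)` remains displayed; it needs the SEPARATION of the (2.1)-chain, which the index of record `SeqOfRecord` does not carry — director-ym LINE №136).
* §5–§6 (v1.1) THE (1.80) DISTANCE LETTER PINNED: `distToSet` (+ `_le_of_mem ∕ _empty ∕ _eq_zero_of_mem`), **`distOfRecord Λ k p := dist_{ℓ¹}(p.src, Λ) ∕ L^k`** (k-block units; [15] (190)'s decay is in block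
  units; `_nonneg`, census `_empty`), **`Node00.Sit189.pinDistAt σ k`**
  (+ faces, commutation), ★ `hdist_pinDistAt` (the input `hdist : ∀ p, 0 ≤ dist p` a THEOREM), `ineq180_D189OfHist_pinDist_iff` (the (1.80) display reads objects of record only: `U_{k,Z}(V_Λ)`,
  `ε_k`, `η_k`, `dist(q, Λ)` — residual: print's constants `B₃ B₅ M δ O(1)`), ★ `claim189_sitOfHist_geom_N0Z_of_flow` (`hZk`, `hbox`, `hdist` all discharged).

LOCATED (nothing asserted): (i) print's family is «cubes intersecting `(Ω″^∼_{h+1})ᶜ` and CONTAINED in `Ω_h`»; the pin takes the cubes MEETING `(Ω″^∼_{h+1})ᶜ ∩ Ω_h` — the same family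
exactly when `Ω_h` and `Ω″^∼_{h+1}` are unions of cubes of the partition (print's standing convention, p. 197 «unions of LM₂R_h-cubes»; [III] (2.1)–(2.3)), a law of def-R's class
`DOfRecord` not used here; without it the pinned family can only be LARGER on boundary cubes, i.e. the antecedent `χ_{h,1/2}` STRONGER — the (1.89) display is then print's or weaker, never
stronger; (ii) the intended side is `σ.sh = cubeSide L M₂ R_h h` (module 4 (iii)); only `0 < σ.sh` is used; (iii) the families `XH`, `XΩ4` of `χ_h(Ω_h∩Z_h)` and `χ_k(Ω_k^{∼4})` stay
letters (no cover input is asked of them).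

HONEST FRAMING.  Count-neutral: a data transformer + finite lattice geometry; NO estimate; nothing of Bałaban's asserted; N12 NOT discharged; one finite four-torus programme at fixed `ε`,
Bałaban AS PRINTED with locators; nothing continuum ∕ ℝ⁴ ∕ OS ∕ mass gap ∕ Clay.  No `sorry`, no `axiom`, no `instance`, no `notation`.
-/

noncomputable section

open scoped BigOperators

namespace Literature.MathematicalPhysics.QuantumFieldTheory.Balaban1983to89

namespace B15Claim189CubePin

open DagBinding T4Continuum Node00
open B14DomainGeom (Pt cubeIdx cubeIdx_le)
open B14.Eq213MaximalDomains (cubeExt)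
open B15Eq112TorusCover (cover lift cover_lift)
open B8Eq17ClassAkV1 (plaqsOf)

section Lattice

variable {P : Params}

/-- **The index of the `s`-cube containing a torus site**, read through the standard section `lift` of the cover (coordinates in `[0, 2L^{m+K})`). [cite: Balaban1988Convergent, (2.17) p.257] -/
def cubeOfSite (s : ℕ) (c : Site P 0) : Pt P.d := cubeIdx s (lift P c)

/-- The cube of `x` ends above `x`: `x_i < s·⌊x_i∕s⌋ + s` (the `s`-cube partition of the cover). [cite: Balaban1988Convergent, (2.17) p.257 (bookkeeping: the cube partition)] -/
theorem lift_lt_mul_cubeIdx_add (s : ℕ) (hs : 0 < s) (x : Pt P.d) (i : Fin P.d) : x i < (s : ℤ) * cubeIdx s x i + s := by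
  have h := Int.emod_add_mul_ediv (x i) (s : ℤ)
  have h1 : x i % (s : ℤ) < (s : ℤ) := Int.emod_lt_of_pos _ (by exact_mod_cast hs)
  unfold cubeIdx
  linarith

/-- A lattice point within `w` of `x` coordinatewise lies in the `w`-collar `cubeExt s (cubeIdx s x) w` of the cube of `x`. [cite: Balaban1988Convergent, (2.16)–(2.17) p.257 (bookkeeping: `□^∼`)] -/
theorem mem_cubeExt_cubeIdx_of_near (s : ℕ) (hs : 0 < s) (x z : Pt P.d) {w : ℤ} (hz : ∀ i, x i - w ≤ z i ∧ z i ≤ x i + w) :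
    z ∈ cubeExt s (cubeIdx s x) w := by
  intro i
  have h1 := cubeIdx_le s hs x i
  have h2 := lift_lt_mul_cubeIdx_add s hs x i
  obtain ⟨hz1, hz2⟩ := hz i
  constructor <;> linarith

/-- The cover intertwines the unit translations: `π (x + e_μ) = (π x).shift μ`. [cite: Balaban1987RG1, (0.1) p.251 (the torus)] -/
theorem cover_add_single (x : Pt P.d) (μ : Fin P.d) : cover P (x + Pi.single μ 1) = (cover P x).shift μ := by
  funext i
  unfold Site.shift
  by_cases h : i = μ
  · subst h
    simp [cover, Function.update_self, Int.cast_add]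
  · simp [cover, h]

/-- The four corners `x, x+e_μ, x+e_ν, x+e_μ+e_ν` of a plaquette are the cover images of the source's lift and its unit translates. [cite: Balaban1985Averaging, (5) p.18 (plaquette convention)] -/
theorem corners_eq_cover (p : Plaq P 0) :
    p.src = cover P (lift P p.src) ∧ p.src.shift p.μ = cover P (lift P p.src + Pi.single p.μ 1) ∧
    p.src.shift p.ν = cover P (lift P p.src + Pi.single p.ν 1) ∧
    (p.src.shift p.μ).shift p.ν = cover P (lift P p.src + Pi.single p.μ 1 + Pi.single p.ν 1) := by
  refine ⟨(cover_lift p.src).symm, ?_, ?_, ?_⟩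
  · rw [cover_add_single, cover_lift]
  · rw [cover_add_single, cover_lift]
  · rw [cover_add_single, cover_add_single, cover_lift]

/-- A plaquette lies INSIDE the one-layer enlargement `□^∼` (`cubeEnl … 1`) of the `s`-cube of its source corner (`1 ≤ s`). [cite: Balaban1988Convergent, (2.17) p.257 («p ⊂ □^∼»)] -/
theorem plaq_mem_plaqInside_cubeEnl_src (s : ℕ) (hs : 0 < s) (p : Plaq P 0) : p ∈ plaqInside (cubeEnl P s (cubeOfSite s p.src) 1) := by
  have hs1 : (1 : ℤ) ≤ ((1 * s : ℕ) : ℤ) := by simp only [one_mul]; exact_mod_cast hs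
  have key : ∀ z : Pt P.d, (∀ i, lift P p.src i - 1 ≤ z i ∧ z i ≤ lift P p.src i + 1) → cover P z ∈ cubeEnl P s (cubeOfSite s p.src) 1 := by
    intro z hz
    refine ⟨z, mem_cubeExt_cubeIdx_of_near s hs (lift P p.src) z (fun i => ⟨?_, ?_⟩), rfl⟩
    · linarith [(hz i).1]
    · linarith [(hz i).2]
  have hsingle : ∀ (μ i : Fin P.d), (0 : ℤ) ≤ (Pi.single μ (1 : ℤ) : Pt P.d) i ∧ (Pi.single μ (1 : ℤ) : Pt P.d) i ≤ 1 := by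
    intro μ i
    by_cases h : i = μ
    · subst h; simp
    · simp [h]
  have hpair : ∀ i : Fin P.d, (0 : ℤ) ≤ (Pi.single p.μ (1 : ℤ) : Pt P.d) i + (Pi.single p.ν (1 : ℤ) : Pt P.d) i ∧
      (Pi.single p.μ (1 : ℤ) : Pt P.d) i + (Pi.single p.ν (1 : ℤ) : Pt P.d) i ≤ 1 := by
    intro i
    have hne : p.μ ≠ p.ν := ne_of_lt p.hμν
    by_cases hμ : i = p.μ
    · subst hμ
      have : (Pi.single p.ν (1 : ℤ) : Pt P.d) p.μ = 0 := by simp [hne]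
      rw [this]; simp
    · by_cases hν : i = p.ν
      · subst hν
        have : (Pi.single p.μ (1 : ℤ) : Pt P.d) p.ν = 0 := by simp [hne.symm]
        rw [this]; simp
      · simp [hμ, hν]
  obtain ⟨h0, h1, h2, h3⟩ := corners_eq_cover p
  refine ⟨?_, ?_, ?_, ?_⟩
  · simpa only [cover_lift] using key (lift P p.src) (fun i => ⟨by linarith, by linarith⟩)
  · rw [h1]; exact key _ (fun i => ⟨by simp only [Pi.add_apply]; linarith [(hsingle p.μ i).1], by simp only [Pi.add_apply]; linarith [(hsingle p.μ i).2]⟩)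
  · rw [h2]; exact key _ (fun i => ⟨by simp only [Pi.add_apply]; linarith [(hsingle p.ν i).1], by simp only [Pi.add_apply]; linarith [(hsingle p.ν i).2]⟩)
  · rw [h3]; exact key _ (fun i => ⟨by simp only [Pi.add_apply]; linarith [(hpair i).1], by simp only [Pi.add_apply]; linarith [(hpair i).2]⟩)

/-- The cube of a torus site is a cube of def-R's partition index family `cubeIndices` (`0 < s`). [cite: Balaban1988Convergent, (2.17) p.257] -/
theorem cubeOfSite_mem_cubeIndices (s : ℕ) (hs : 0 < s) (c : Site P 0) : cubeOfSite s c ∈ cubeIndices P s := by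
  unfold cubeIndices cubeOfSite
  rw [Fintype.mem_piFinset]
  intro i
  rw [Finset.mem_image]
  refine ⟨(c i).val / s, ?_, ?_⟩
  · rw [Finset.mem_range]
    have hv : (c i).val < P.sitesPerDir 0 := ZMod.val_lt _
    have h1 : (c i).val / s ≤ (P.sitesPerDir 0 - 1) / s := Nat.div_le_div_right (by omega)
    have h2 : (P.sitesPerDir 0 + s - 1) / s = (P.sitesPerDir 0 - 1) / s + 1 := by
      rw [show P.sitesPerDir 0 + s - 1 = (P.sitesPerDir 0 - 1) + s by omega, Nat.add_div_right _ hs]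
    omega
  · unfold cubeIdx lift
    simp only [Int.natCast_ediv]

/-- A site lies in its own cube `□ = cubeEnl … 0`. [cite: Balaban1988Convergent, (2.17) p.257] -/
theorem mem_cubeEnl_cubeOfSite (s : ℕ) (hs : 0 < s) (c : Site P 0) : c ∈ cubeEnl P s (cubeOfSite s c) 0 := by
  refine ⟨lift P c, ?_, cover_lift c⟩
  exact mem_cubeExt_cubeIdx_of_near s hs (lift P c) (lift P c) (w := ((0 * s : ℕ) : ℤ)) (fun i => ⟨by simp, by simp⟩)

/-- **ANY CORNER'S CUBE WORKS**: for a corner `c` of `p`, the plaquette lies INSIDE the one-layer enlargement `□^∼` of the `s`-cube of `c` (`1 ≤ s`) — the source's lift and the corner's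
lift differ by the corner's offset up to a deck translation, and two corners' offsets differ by at most one step coordinatewise. [cite: Balaban1988Convergent, (2.17) p.257 («p ⊂ □^∼»); Balaban1987RG1, (0.1) p.251] -/
theorem plaq_mem_plaqInside_cubeEnl_of_corner (s : ℕ) (hs : 0 < s) (p : Plaq P 0) {c : Site P 0}
    (hc : c = p.src ∨ c = p.src.shift p.μ ∨ c = p.src.shift p.ν ∨ c = (p.src.shift p.μ).shift p.ν) :
    p ∈ plaqInside (cubeEnl P s (cubeOfSite s c) 1) := by
  -- the offsets of the four corners from the source's lift
  obtain ⟨h0, h1, h2, h3⟩ := corners_eq_cover p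
  have hsingle : ∀ (μ i : Fin P.d), (0 : ℤ) ≤ (Pi.single μ (1 : ℤ) : Pt P.d) i ∧ (Pi.single μ (1 : ℤ) : Pt P.d) i ≤ 1 := by
    intro μ i
    by_cases h : i = μ
    · subst h; simp
    · simp [h]
  have hpair : ∀ i : Fin P.d, (0 : ℤ) ≤ (Pi.single p.μ (1 : ℤ) : Pt P.d) i + (Pi.single p.ν (1 : ℤ) : Pt P.d) i ∧
      (Pi.single p.μ (1 : ℤ) : Pt P.d) i + (Pi.single p.ν (1 : ℤ) : Pt P.d) i ≤ 1 := by
    intro i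
    have hne : p.μ ≠ p.ν := ne_of_lt p.hμν
    by_cases hμ : i = p.μ
    · subst hμ
      have : (Pi.single p.ν (1 : ℤ) : Pt P.d) p.μ = 0 := by simp [hne]
      rw [this]; simp
    · by_cases hν : i = p.ν
      · subst hν
        have : (Pi.single p.μ (1 : ℤ) : Pt P.d) p.ν = 0 := by simp [hne.symm]
        rw [this]; simp
      · simp [hμ, hν]
  -- a uniform statement: every corner is `cover (x + v)` with `0 ≤ v ≤ 1` coordinatewise
  set x := lift P p.src with hx
  have hcorners : ∀ c' : Site P 0, (c' = p.src ∨ c' = p.src.shift p.μ ∨ c' = p.src.shift p.ν ∨ c' = (p.src.shift p.μ).shift p.ν) →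
      ∃ v : Pt P.d, c' = cover P (x + v) ∧ ∀ i, 0 ≤ v i ∧ v i ≤ 1 := by
    intro c' hc'
    rcases hc' with rfl | rfl | rfl | rfl
    · exact ⟨0, by simpa using h0, fun i => by simp⟩
    · exact ⟨Pi.single p.μ 1, h1, hsingle p.μ⟩
    · exact ⟨Pi.single p.ν 1, h2, hsingle p.ν⟩
    · exact ⟨Pi.single p.μ 1 + Pi.single p.ν 1, by rw [h3, add_assoc], fun i => by simpa only [Pi.add_apply] using hpair i⟩
  obtain ⟨vc, hcv, hvc⟩ := hcorners c hc
  -- the corner's own lift: `x + vc = lift c + P·w`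
  obtain ⟨w, hw⟩ := (B15Eq112TorusCover.cover_eq_cover_iff (lift P c) (x + vc)).1 (by rw [cover_lift, ← hcv])
  -- every corner lies in `□^∼` of the cube of `c`
  have key : ∀ c' : Site P 0, (c' = p.src ∨ c' = p.src.shift p.μ ∨ c' = p.src.shift p.ν ∨ c' = (p.src.shift p.μ).shift p.ν) →
      c' ∈ cubeEnl P s (cubeOfSite s c) 1 := by
    intro c' hc'
    obtain ⟨v, hv, hvb⟩ := hcorners c' hc'
    have heq : x + v = (lift P c + (v - vc)) + B15LatticeCubeTorus.pmul (B15Eq112TorusCover.per P) w := by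
      have : x + v = (x + vc) + (v - vc) := by abel
      rw [this, hw]; abel
    refine ⟨lift P c + (v - vc), mem_cubeExt_cubeIdx_of_near s hs (lift P c) _ (fun i => ⟨?_, ?_⟩), ?_⟩
    · simp only [Pi.add_apply, Pi.sub_apply]
      have := (hvb i).1; have := (hvc i).2
      push_cast; linarith
    · simp only [Pi.add_apply, Pi.sub_apply]
      have := (hvb i).2; have := (hvc i).1
      push_cast; linarith
    · rw [hv, heq, B15Eq112TorusCover.cover_add_pmul]
  exact ⟨key _ (Or.inl rfl), key _ (Or.inr (Or.inl rfl)), key _ (Or.inr (Or.inr (Or.inl rfl))), key _ (Or.inr (Or.inr (Or.inr rfl)))⟩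

end Lattice

/-! ## §2. The corner in the half domain and THE CUBE PIN -/

section Pin

variable {F : T4Family} {N : ℕ} [NeZero N]

open Classical in
/-- **A corner of the plaquette `p` lying in `S`** when `p` touches `S` (the source otherwise): print p. 198 takes, for a plaquette of the half domain, *«a cube □ ⊂ (Ω″^∼_{h+1})ᶜ ∩ Ω_h»*
containing it — the cube of THIS corner. [cite: Balaban1989LargeFieldI, (1.88)–(1.90) p.198] -/
def plaqCornerIn {P : Params} (S : Set (Site P 0)) (p : Plaq P 0) : Site P 0 :=
  if p.src ∈ S then p.src else if p.src.shift p.μ ∈ S then p.src.shift p.μ else if p.src.shift p.ν ∈ S then p.src.shift p.ν else (p.src.shift p.μ).shift p.ν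

/-- `plaqCornerIn S p` is one of the four corners of `p`. [cite: Balaban1985RegularSpaces, p.77 (plaquette convention)] -/
theorem plaqCornerIn_isCorner {P : Params} (S : Set (Site P 0)) (p : Plaq P 0) :
    plaqCornerIn S p = p.src ∨ plaqCornerIn S p = p.src.shift p.μ ∨ plaqCornerIn S p = p.src.shift p.ν ∨ plaqCornerIn S p = (p.src.shift p.μ).shift p.ν := by
  unfold plaqCornerIn
  split_ifs <;> simp

/-- For a plaquette TOUCHING `S` the chosen corner lies in `S`. [cite: Balaban1985RegularSpaces, p.77 (plaquette convention)] -/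
theorem plaqCornerIn_mem {P : Params} (S : Set (Site P 0)) {p : Plaq P 0} (hp : p ∈ plaqsOf S) : plaqCornerIn S p ∈ S := by
  rw [B8Eq17ClassAkV1.mem_plaqsOf] at hp
  unfold plaqCornerIn
  split_ifs with h1 h2 h3
  · exact h1
  · exact h2
  · exact h3
  · tauto

open Classical in
/-- **THE (1.89) SITUATION WITH ITS (1.88) CUBE DATA PINNED to def-R's `σ.sh`-partition over a site set `S` (the half domain)**: the cube family of `χ_{h,1/2}` := the cubes of the partition
MEETING `S` (print p. 198: *«the product over cubes □ intersecting the domain (Ω″^∼_{h+1})ᶜ and contained in Ω_h»* — for `S = (Ω″^∼_{h+1})ᶜ ∩ Ω_h` and `Ω_h` a union of partition cubes,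
print's standing convention p. 197, these are the cubes meeting `S`), and the cube of a plaquette := the cube of its corner in `S`.  Everything else unchanged.  Data, no law.
[cite: Balaban1989LargeFieldI, (1.88) p.198, p.197; Balaban1988Convergent, (2.17) p.257] -/
def _root_.Literature.MathematicalPhysics.QuantumFieldTheory.Balaban1983to89.Node00.Sit189.pinCubes {K : ℕ} (σ : Sit189 F N K) (S : Set (Site (F.P K) 0)) :
    Sit189 F N K :=
  { σ with
    Xhalf := (cubeIndices (F.P K) σ.sh).filter fun a => (cubeEnl (F.P K) σ.sh a 0 ∩ S).Nonempty
    boxOf := fun p => cubeOfSite σ.sh (plaqCornerIn S p) }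

variable {K : ℕ} (σ : Sit189 F N K) (S : Set (Site (F.P K) 0))

/-- The pinned cube data (`rfl` ×2). [cite: Balaban1989LargeFieldI, (1.88) p.198 (bookkeeping)] -/
theorem pinCubes_Xhalf_boxOf : (σ.pinCubes S).boxOf = (fun p => cubeOfSite σ.sh (plaqCornerIn S p)) ∧
    (∀ a, a ∈ (σ.pinCubes S).Xhalf ↔ a ∈ cubeIndices (F.P K) σ.sh ∧ (cubeEnl (F.P K) σ.sh a 0 ∩ S).Nonempty) := by
  refine ⟨rfl, fun a => ?_⟩
  classical
  show a ∈ (cubeIndices (F.P K) σ.sh).filter (fun a => (cubeEnl (F.P K) σ.sh a 0 ∩ S).Nonempty) ↔ _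
  rw [Finset.mem_filter]

/-- The pin keeps the chart carrier and letter, levels, cube sides, regions, numbers, the other cube families and the deviation letters (`rfl`).
[cite: Balaban1989LargeFieldI, (1.89) p.198 (bookkeeping)] -/
theorem pinCubes_kept : (σ.pinCubes S).𝔤 = σ.𝔤 ∧ HEq (σ.pinCubes S).chiP σ.chiP ∧ (σ.pinCubes S).h = σ.h ∧ (σ.pinCubes S).k₀ = σ.k₀ ∧ (σ.pinCubes S).k = σ.k ∧
    (σ.pinCubes S).sh = σ.sh ∧ (σ.pinCubes S).sk = σ.sk ∧ (σ.pinCubes S).Ω = σ.Ω ∧ (σ.pinCubes S).Zpp = σ.Zpp ∧ (σ.pinCubes S).Z = σ.Z ∧ (σ.pinCubes S).Λ = σ.Λ ∧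
    (σ.pinCubes S).OmT = σ.OmT ∧ (σ.pinCubes S).ΩppT2 = σ.ΩppT2 ∧ (σ.pinCubes S).XH = σ.XH ∧ (σ.pinCubes S).XΩ4 = σ.XΩ4 ∧ (σ.pinCubes S).β = σ.β ∧
    (σ.pinCubes S).L₀ = σ.L₀ ∧ (σ.pinCubes S).M = σ.M ∧ (σ.pinCubes S).dist = σ.dist ∧ (σ.pinCubes S).dev0 = σ.dev0 ∧ (σ.pinCubes S).devV'' = σ.devV'' ∧
    (σ.pinCubes S).dev97 = σ.dev97 :=
  ⟨rfl, HEq.rfl, rfl, rfl, rfl, rfl, rfl, rfl, rfl, rfl, rfl, rfl, rfl, rfl, rfl, rfl, rfl, rfl, rfl, rfl, rfl, rfl⟩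

/-- The cube pin commutes with the term, levels, `Z″`, χ′ and `dev0` pins (`rfl`: disjoint fields; it reads only `sh` and `S`). [cite: Balaban1989LargeFieldI, (1.89) p.198 (bookkeeping)] -/
theorem pinCubes_comm {D : ℕ → Set (Set (Site (F.P K) 0))} {k' : ℕ} (s : B14.Eq218Concrete.Seq D k') (M Nm N₀ N₀' Nm' : ℕ)
    (enl : ℕ → ℕ → Set (Site (F.P K) 0) → Set (Site (F.P K) 0)) (δ' : ℝ) (ν : Stage7Numerics) :
    (σ.pinCubes S).pinTerm s = (σ.pinTerm s).pinCubes S ∧ (σ.pinCubes S).pinLevels M Nm N₀ = (σ.pinLevels M Nm N₀).pinCubes S ∧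
    (σ.pinCubes S).pinZpp s N₀' Nm' enl = (σ.pinZpp s N₀' Nm' enl).pinCubes S ∧ (σ.pinCubes S).pinChi182 δ' = (σ.pinChi182 δ').pinCubes S ∧
    (σ.pinCubes S).pinDev0 ν = (σ.pinDev0 ν).pinCubes S := ⟨rfl, rfl, rfl, rfl, rfl⟩

end Pin

/-! ## §3. THE (1.88) CUBE COVER `hbox` IS A THEOREM at the cube-pinned letters -/

section HBox

open B15Claim189Assembly (Setting189 half)
open B15Claim189PinsOfHistory (D189OfHist sitOfHist)
open B15Claim189PrintedConditions (omegaOfChain)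

variable {F : T4Family} {N : ℕ} [NeZero N] (ν : Stage7Numerics) (P : B12.RunParams) (σ : Sit189 F N P.K) (g : ℕ → ℝ)

/-- **MODULES 4 ∕ 11's LOCATED INPUT `hbox` DISCHARGED AT THE CUBE PIN OVER THE HALF DOMAIN**: for the letters `D = D189OfHist ν P (σ.pinCubes (σ.OmTᶜ ∩ σ.Ω σ.h)) g` (positive cube side),
every plaquette touching the half domain `(Ω″^∼_{h+1})ᶜ ∩ Ω_h` has its cube in the family of `χ_{h,1/2}` and lies INSIDE that cube's one-layer enlargement `□^∼` (print p. 198: *«Take a cube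
□ ⊂ (Ω″^∼_{h+1})ᶜ ∩ Ω_h, and represent the functions U″_{k,Z} on □^∼»*). [cite: Balaban1989LargeFieldI, (1.88)–(1.90) p.198; Balaban1988Convergent, (2.17) p.257] -/
theorem hbox_D189OfHist_pinCubes (hsh : 0 < σ.sh)
    {D : Setting189 (F.P P.K) (SU N) (B15DeterminingSets.MSField (F.P P.K) (SU N) × ((j : ℕ) → VecField (F.P P.K) j σ.𝔤)) (Pt (F.P P.K).d)}
    (hD : D = D189OfHist ν P (σ.pinCubes (σ.OmTᶜ ∩ σ.Ω σ.h)) g) :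
    ∀ p ∈ plaqsOf (half D), D.boxOf p ∈ D.halfcubes ∧ p ∈ D.plaqT (D.boxOf p) := by
  subst hD
  intro p hp
  change p ∈ plaqsOf (σ.OmTᶜ ∩ σ.Ω σ.h) at hp
  refine ⟨?_, ?_⟩
  · show cubeOfSite σ.sh (plaqCornerIn (σ.OmTᶜ ∩ σ.Ω σ.h) p) ∈ (↑((σ.pinCubes (σ.OmTᶜ ∩ σ.Ω σ.h)).Xhalf) : Set (Pt (F.P P.K).d))
    rw [Finset.mem_coe, (pinCubes_Xhalf_boxOf σ _).2]
    exact ⟨cubeOfSite_mem_cubeIndices σ.sh hsh _, plaqCornerIn _ p, mem_cubeEnl_cubeOfSite σ.sh hsh _, plaqCornerIn_mem _ hp⟩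
  · exact plaq_mem_plaqInside_cubeEnl_of_corner σ.sh hsh p (plaqCornerIn_isCorner _ p)

variable {ν} {A₁ : ℝ} {M : ℕ} (Nm : ℕ) {k' : ℕ} (s : SeqOfRecord F ν M g P.K k') (N₀ p₁ : ℕ)

/-- **… AND AT THE TERM'S FULLY PINNED SITUATION** (the half domain there: `Ω″^∼_{h+1}` the situation's letter `σ.OmT`, `Ω_h` = the term's clamped chain at `h = k′ − N`): for
`D = D189OfHist ν P (sitOfHist ν A₁ M N P (σ.pinCubes (σ.OmTᶜ ∩ omegaOfChain s (k′ − N))) g s N₀ p₁) g` the input `hbox` of `claim189_sitOfHist_*` HOLDS (`0 < σ.sh`).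
[cite: Balaban1989LargeFieldI, (1.88)–(1.90) p.198; Balaban1988Convergent, (2.1) p.254, (2.17) p.257] -/
theorem hbox_sitOfHist_pinCubes (hsh : 0 < σ.sh)
    {D : Setting189 (F.P P.K) (SU N) (B15DeterminingSets.MSField (F.P P.K) (SU N) × ((j : ℕ) → VecField (F.P P.K) j (EuclideanSpace ℝ (Fin (N ^ 2 - 1))))) (Pt (F.P P.K).d)}
    (hD : D = D189OfHist ν P (sitOfHist ν A₁ M Nm P (σ.pinCubes (σ.OmTᶜ ∩ omegaOfChain s (k' - Nm))) g s N₀ p₁) g) :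
    ∀ p ∈ plaqsOf (half D), D.boxOf p ∈ D.halfcubes ∧ p ∈ D.plaqT (D.boxOf p) := by
  subst hD
  intro p hp
  change p ∈ plaqsOf (σ.OmTᶜ ∩ omegaOfChain s (k' - Nm)) at hp
  refine ⟨?_, ?_⟩
  · show cubeOfSite σ.sh (plaqCornerIn (σ.OmTᶜ ∩ omegaOfChain s (k' - Nm)) p) ∈ (↑((σ.pinCubes (σ.OmTᶜ ∩ omegaOfChain s (k' - Nm))).Xhalf) : Set (Pt (F.P P.K).d))
    rw [Finset.mem_coe, (pinCubes_Xhalf_boxOf σ _).2]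
    exact ⟨cubeOfSite_mem_cubeIndices σ.sh hsh _, plaqCornerIn _ p, mem_cubeEnl_cubeOfSite σ.sh hsh _, plaqCornerIn_mem _ hp⟩
  · exact plaq_mem_plaqInside_cubeEnl_of_corner σ.sh hsh p (plaqCornerIn_isCorner _ p)

end HBox

/-! ## §4. The (1.89) display along a history with the (1.88) cube cover DISCHARGED (and, at the `Z″` pin, «We have j = k» too) -/

section Display

open B15 (Ineq180)
open B15.BasicStep (Claim189)
open B15.PrelimIntegrations (Ineq191 Ineq195)
open B15Chi124DetSets (E124)
open B15DeterminingSets (MSField)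
open B15Claim189Assembly (Setting189 new189 chiPP dom half)
open B15Claim189PinsOfHistory (D189OfHist sitOfHist claim189_sitOfHist_of_flow claim189_sitOfHist_N0Z_of_flow)
open B15Claim189PrintedConditions (omegaOfChain)
open B15Claim189N0OfRecord (N0OfSeq)
open GaugeGroup (dist1)
open GaugeField (plaqHol)

variable {F : T4Family} {N : ℕ} [NeZero N] {ν : Stage7Numerics} {A₁ : ℝ} {M : ℕ} (Nm : ℕ) (P : B12.RunParams) (σ : Sit189 F N P.K) {g : ℕ → ℝ} {k' : ℕ}
  (s : SeqOfRecord F ν M g P.K k') (N₀ p₁ : ℕ)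

/-- **(1.89) AT THE TERM'S FULLY PINNED LETTERS WITH THE CUBE DATA PINNED — `hbox` DISCHARGED** (module 14's `claim189_sitOfHist_of_flow` at `σ.pinCubes ((Ω″^∼_{h+1})ᶜ ∩ Ω_h)`, `0 < σ.sh`):
window-free form; remaining located geometry: `Z″_{k′} ∩ Ω_m ⊆ Ω_{m+1}` and the shell bound. [cite: Balaban1989LargeFieldI, (1.89) p.198, (1.88)–(1.90) p.198, pp.199–200; Balaban1988Convergent, (2.1) p.254, (2.17) p.257] -/
theorem claim189_sitOfHist_cubes_of_flow (hsh : 0 < σ.sh)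
    {D : Setting189 (F.P P.K) (SU N) (MSField (F.P P.K) (SU N) × ((j : ℕ) → VecField (F.P P.K) j (EuclideanSpace ℝ (Fin (N ^ 2 - 1))))) (Pt (F.P P.K).d)}
    (hD : D = D189OfHist ν P (sitOfHist ν A₁ M Nm P (σ.pinCubes (σ.OmTᶜ ∩ omegaOfChain s (k' - Nm))) g s N₀ p₁) g)
    (hN2 : 2 ≤ N₀) (hNN : N₀ ≤ Nm) (hNk : N₀ ≤ k')
    (hβ0 : 0 ≤ σ.β) (hβ : σ.β ≤ 1 / 4) (hL₀ : 2 ≤ σ.L₀) (hL₀L : σ.L₀ ^ 2 ≤ ((F.P P.K).L : ℝ))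
    (hB : 0 ≤ σ.O1 * σ.B₃ * σ.B₅) (hδ : 0 ≤ σ.δ) (hdist : ∀ p, 0 ≤ σ.dist p)
    (hN₀ : (2 + (121 / 120) ^ 2 * (σ.O1 * σ.B₃ * σ.B₅ * (M : ℝ) ^ 5)) * ((σ.L₀ ^ 2) ^ (N₀ - 1))⁻¹ ≤ 1 / 4)
    (hMl : (121 / 120) ^ 2 * (σ.O1 * σ.B₃ * σ.B₅ * (M : ℝ) ^ 5) * Real.exp (-(4 * σ.δ * (M : ℝ))) ≤ 1 / 12)
    (hε0 : ∀ i, k' - Nm ≤ i → i ≤ k' → 0 ≤ epsOfRecord ν g i) (hε1 : ∀ i, k' - Nm ≤ i → i ≤ k' → epsOfRecord ν g i ≤ 1 / 10)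
    {β₀ : ℝ} (hβ₀0 : 0 ≤ β₀) (hβ₀ : β₀ ≤ 1 / 2)
    (hflow : ∀ j, k' - Nm ≤ j → j < k' → epsOfRecord ν g k' ≤ (1 + β₀) * Real.sqrt ((k' - j : ℕ) : ℝ) * epsOfRecord ν g j)
    (hZk : ∀ m, k' - N₀ < m → m < k' → σ.Zpp k' ∩ omegaOfChain s m ⊆ omegaOfChain s (m + 1))
    (hgeom : ∀ m, D.k₀ < m → m < D.k → ∀ p ∈ plaqsOf (D.Ω m \ D.Ω (m + 1)), 4 * ((m : ℝ) - D.k₀) * D.M ≤ D.dist p)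
    (L91h : ∀ U, new189 D U → ∀ p ∈ plaqsOf (half D),
      Ineq191 (dist1 (plaqHol (D.Upp U) p)) (D.devV'' U p) D.α ((D.L ^ D.h)⁻¹) (D.ε D.h) (E124 D.ε D.L D.η D.k D.h))
    (L95 : ∀ U, new189 D U → ∀ p ∈ plaqsOf (half D),
      Ineq195 (D.devV'' U p) (dist1 (plaqHol (D.Uhalf U (D.boxOf p)) p)) D.α ((D.L ^ D.h)⁻¹) (D.ε D.h) (E124 D.ε D.L D.η D.k D.h))
    (L91 : ∀ U, new189 D U → ∀ j, D.h ≤ j → j ≤ D.k → ∀ p ∈ plaqsOf (dom D j),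
      Ineq191 (dist1 (plaqHol (D.Upp U) p)) (D.dev97 U p) D.α ((D.L ^ j)⁻¹) (D.ε j) (E124 D.ε D.L D.η D.k j))
    (L97 : ∀ U, new189 D U → ∀ j, D.h ≤ j → j ≤ D.k → ∀ p ∈ plaqsOf (dom D j),
      Ineq191 (D.dev97 U p) (D.dev0 U p) D.α ((D.L ^ j)⁻¹) (D.ε j) (E124 D.ε D.L D.η D.k j))
    (L80 : ∀ U, new189 D U → ∀ j, D.h ≤ j → j ≤ D.k → ∀ p ∈ plaqsOf (dom D j),
      Ineq180 (D.dev0 U p) (D.ε D.k) D.η D.B₃ D.B₅ D.M D.δ (D.dist p) D.O1) :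
    Claim189 (new189 D) (chiPP D) :=
  claim189_sitOfHist_of_flow Nm P (σ.pinCubes (σ.OmTᶜ ∩ omegaOfChain s (k' - Nm))) s N₀ p₁ hD hN2 hNN hNk hβ0 hβ hL₀ hL₀L hB hδ hdist hN₀ hMl hε0 hε1 hβ₀0 hβ₀
    hflow hZk hgeom (hbox_sitOfHist_pinCubes P σ g Nm s N₀ p₁ hsh hD) L91h L95 L91 L97 L80

/-- **(1.89) WITH `N₀` OF THE HISTORY, PRINT'S `Z″_j` AND THE CUBE DATA PINNED — `hZk` AND `hbox` BOTH DISCHARGED** (module 14's `claim189_sitOfHist_N0Z_of_flow` at the cube pin; `0 < σ.sh`,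
enlargement inflationary): of the located geometry only the shell bound `4(m − k₀)M ≤ dist(p, Λ)` remains displayed. [cite: Balaban1989LargeFieldI, (1.89) p.198, (1.10)–(1.11) p.179, (1.88) p.198, pp.199–200; Balaban1988Convergent, (2.1) p.254, (2.17) p.257] -/
theorem claim189_sitOfHist_cubes_N0Z_of_flow (hsh : 0 < σ.sh) (enl : ℕ → ℕ → Set (Site (F.P P.K) 0) → Set (Site (F.P P.K) 0))
    (henl : ∀ n j (S : Set (Site (F.P P.K) 0)), S ⊆ enl n j S)
    {D : Setting189 (F.P P.K) (SU N) (MSField (F.P P.K) (SU N) × ((j : ℕ) → VecField (F.P P.K) j (EuclideanSpace ℝ (Fin (N ^ 2 - 1))))) (Pt (F.P P.K).d)}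
    (hD : D = D189OfHist ν P (sitOfHist ν A₁ M Nm P ((σ.pinCubes (σ.OmTᶜ ∩ omegaOfChain s (k' - Nm))).pinZpp s (N0OfSeq (F.P P.K).L ν.r g k') Nm enl) g s
      (N0OfSeq (F.P P.K).L ν.r g k') p₁) g)
    (hlog : 1 < (Real.log (g k' ^ 2)⁻¹) ^ ν.r) (hNN : N0OfSeq (F.P P.K).L ν.r g k' ≤ Nm) (hNk : N0OfSeq (F.P P.K).L ν.r g k' ≤ k')
    (hβ0 : 0 ≤ σ.β) (hβ : σ.β ≤ 1 / 4) (hL₀ : 2 ≤ σ.L₀) (hL₀L : σ.L₀ ^ 2 ≤ ((F.P P.K).L : ℝ))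
    (hB : 0 ≤ σ.O1 * σ.B₃ * σ.B₅) (hδ : 0 ≤ σ.δ) (hdist : ∀ p, 0 ≤ σ.dist p)
    (hN₀ : (2 + (121 / 120) ^ 2 * (σ.O1 * σ.B₃ * σ.B₅ * (M : ℝ) ^ 5)) * ((σ.L₀ ^ 2) ^ (N0OfSeq (F.P P.K).L ν.r g k' - 1))⁻¹ ≤ 1 / 4)
    (hMl : (121 / 120) ^ 2 * (σ.O1 * σ.B₃ * σ.B₅ * (M : ℝ) ^ 5) * Real.exp (-(4 * σ.δ * (M : ℝ))) ≤ 1 / 12)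
    (hε0 : ∀ i, k' - Nm ≤ i → i ≤ k' → 0 ≤ epsOfRecord ν g i) (hε1 : ∀ i, k' - Nm ≤ i → i ≤ k' → epsOfRecord ν g i ≤ 1 / 10)
    {β₀ : ℝ} (hβ₀0 : 0 ≤ β₀) (hβ₀ : β₀ ≤ 1 / 2)
    (hflow : ∀ j, k' - Nm ≤ j → j < k' → epsOfRecord ν g k' ≤ (1 + β₀) * Real.sqrt ((k' - j : ℕ) : ℝ) * epsOfRecord ν g j)
    (hgeom : ∀ m, D.k₀ < m → m < D.k → ∀ p ∈ plaqsOf (D.Ω m \ D.Ω (m + 1)), 4 * ((m : ℝ) - D.k₀) * D.M ≤ D.dist p)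
    (L91h : ∀ U, new189 D U → ∀ p ∈ plaqsOf (half D),
      Ineq191 (dist1 (plaqHol (D.Upp U) p)) (D.devV'' U p) D.α ((D.L ^ D.h)⁻¹) (D.ε D.h) (E124 D.ε D.L D.η D.k D.h))
    (L95 : ∀ U, new189 D U → ∀ p ∈ plaqsOf (half D),
      Ineq195 (D.devV'' U p) (dist1 (plaqHol (D.Uhalf U (D.boxOf p)) p)) D.α ((D.L ^ D.h)⁻¹) (D.ε D.h) (E124 D.ε D.L D.η D.k D.h))
    (L91 : ∀ U, new189 D U → ∀ j, D.h ≤ j → j ≤ D.k → ∀ p ∈ plaqsOf (dom D j),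
      Ineq191 (dist1 (plaqHol (D.Upp U) p)) (D.dev97 U p) D.α ((D.L ^ j)⁻¹) (D.ε j) (E124 D.ε D.L D.η D.k j))
    (L97 : ∀ U, new189 D U → ∀ j, D.h ≤ j → j ≤ D.k → ∀ p ∈ plaqsOf (dom D j),
      Ineq191 (D.dev97 U p) (D.dev0 U p) D.α ((D.L ^ j)⁻¹) (D.ε j) (E124 D.ε D.L D.η D.k j))
    (L80 : ∀ U, new189 D U → ∀ j, D.h ≤ j → j ≤ D.k → ∀ p ∈ plaqsOf (dom D j),
      Ineq180 (D.dev0 U p) (D.ε D.k) D.η D.B₃ D.B₅ D.M D.δ (D.dist p) D.O1) :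
    Claim189 (new189 D) (chiPP D) :=
  claim189_sitOfHist_N0Z_of_flow Nm P (σ.pinCubes (σ.OmTᶜ ∩ omegaOfChain s (k' - Nm))) s p₁ enl henl hD hlog hNN hNk hβ0 hβ hL₀ hL₀L hB hδ hdist hN₀ hMl hε0 hε1
    hβ₀0 hβ₀ hflow hgeom (hbox_sitOfHist_pinCubes P (σ.pinZpp s (N0OfSeq (F.P P.K).L ν.r g k') Nm enl) g Nm s _ p₁ hsh (by subst hD; rfl)) L91h L95 L91 L97 L80

end Display

/-! ## §5. (v1.1) The (1.80) distance `dist(p, Λ)` OF RECORD -/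

section Dist

variable {P : Params}

/-- **The lattice distance from a site to a site set** (fine `ℓ¹` torus steps, `Site.tdist`; `0` for the empty set — `sInf ∅ = 0` in `ℕ`). [cite: Balaban1989LargeFieldI, (1.80) p.195 («dist(p, Λ)»)] -/
def distToSet (Λ : Set (Site P 0)) (x : Site P 0) : ℕ := sInf (Site.tdist x '' Λ)

/-- The distance to a set is at most the distance to any of its points. [cite: Balaban1989LargeFieldI, (1.80) p.195 (bookkeeping)] -/
theorem distToSet_le_of_mem (Λ : Set (Site P 0)) (x : Site P 0) {y : Site P 0} (hy : y ∈ Λ) : distToSet Λ x ≤ Site.tdist x y :=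
  Nat.sInf_le ⟨y, hy, rfl⟩

/-- The distance to the empty set is `0` (the convention of `sInf` on `ℕ`). [cite: Balaban1989LargeFieldI, (1.80) p.195 (bookkeeping)] -/
theorem distToSet_empty (x : Site P 0) : distToSet (∅ : Set (Site P 0)) x = 0 := by
  simp [distToSet]

/-- A site of `Λ` has distance `0` to `Λ` (`tdist x x = 0`). [cite: Balaban1989LargeFieldI, (1.80) p.195 (bookkeeping)] -/
theorem distToSet_eq_zero_of_mem {Λ : Set (Site P 0)} {x : Site P 0} (hx : x ∈ Λ) : distToSet Λ x = 0 := by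
  have h := distToSet_le_of_mem Λ x hx
  have h0 : Site.tdist x x = 0 := by simp [Site.tdist]
  omega

/-- **`dist(p, Λ)` OF RECORD at step `k`** — the fine `ℓ¹` torus distance of the plaquette's source to the letter `Λ`, IN k-BLOCK UNITS (one step of the k-th unit lattice = `L^k` fine
steps): the distance entering (1.80)'s `exp(−δ dist(p, Λ))` ([15] (190)'s decay is in block units). [cite: Balaban1989LargeFieldI, (1.79)–(1.80) p.195; Balaban1985Variational, (190) p.308] -/
def distOfRecord (Λ : Set (Site P 0)) (k : ℕ) : Plaq P 0 → ℝ := fun p => (distToSet Λ p.src : ℝ) / (P.L : ℝ) ^ k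

/-- `dist(p, Λ)` of record is nonnegative. [cite: Balaban1989LargeFieldI, (1.80) p.195 (bookkeeping)] -/
theorem distOfRecord_nonneg (Λ : Set (Site P 0)) (k : ℕ) (p : Plaq P 0) : 0 ≤ distOfRecord Λ k p :=
  div_nonneg (Nat.cast_nonneg _) (pow_nonneg (Nat.cast_nonneg _) _)

/-- CENSUS (A2): at the degenerate letter `Λ = ∅` the pinned distance is `0` everywhere — so after the pin the shell bound `hgeom` (`4(m − k₀)M ≤ dist(p, Λ)`) FAILS at `Λ = ∅` as soon as
`M > 0` and some shell `Ω_m∖Ω_{m+1}`, `k₀ < m < k`, has a plaquette: the junk letter no longer passes. [cite: Balaban1989LargeFieldI, (1.80) p.195, p.200 (bookkeeping census)] -/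
theorem distOfRecord_empty (k : ℕ) (p : Plaq P 0) : distOfRecord (∅ : Set (Site P 0)) k p = 0 := by
  simp [distOfRecord, distToSet_empty]

/-- Unfolding. [cite: Balaban1989LargeFieldI, (1.80) p.195 (bookkeeping)] -/
theorem distOfRecord_apply (Λ : Set (Site P 0)) (k : ℕ) (p : Plaq P 0) : distOfRecord Λ k p = (distToSet Λ p.src : ℝ) / (P.L : ℝ) ^ k := rfl

end Dist

/-! ## §6. (v1.1) The distance letter PINNED; `hdist` a theorem; the (1.80) display reads objects of record only; the display with `hbox` ∧ `hdist` discharged -/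

section DistPin

variable {F : T4Family} {N : ℕ} [NeZero N]

/-- **THE (1.89) SITUATION WITH ITS (1.80) DISTANCE LETTER PINNED**: `dist := dist(·, Λ)` of record at step `k` (the situation's own letter `Λ`; `k` a parameter — at the term pin `k = k′`).
Everything else unchanged.  Data, no law. [cite: Balaban1989LargeFieldI, (1.79)–(1.80) p.195] -/
def _root_.Literature.MathematicalPhysics.QuantumFieldTheory.Balaban1983to89.Node00.Sit189.pinDistAt {K : ℕ} (σ : Sit189 F N K) (k : ℕ) : Sit189 F N K :=
  { σ with dist := distOfRecord σ.Λ k }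

variable {K : ℕ} (σ : Sit189 F N K) (k : ℕ)

/-- The pinned letter (`rfl`). [cite: Balaban1989LargeFieldI, (1.80) p.195 (bookkeeping)] -/
theorem pinDistAt_dist : (σ.pinDistAt k).dist = distOfRecord σ.Λ k := rfl

/-- The pin keeps every other field (`rfl`; `HEq` for the chart letter). [cite: Balaban1989LargeFieldI, (1.89) p.198 (bookkeeping)] -/
theorem pinDistAt_kept : (σ.pinDistAt k).𝔤 = σ.𝔤 ∧ HEq (σ.pinDistAt k).chiP σ.chiP ∧ (σ.pinDistAt k).h = σ.h ∧ (σ.pinDistAt k).k₀ = σ.k₀ ∧ (σ.pinDistAt k).k = σ.k ∧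
    (σ.pinDistAt k).sh = σ.sh ∧ (σ.pinDistAt k).sk = σ.sk ∧ (σ.pinDistAt k).Ω = σ.Ω ∧ (σ.pinDistAt k).Zpp = σ.Zpp ∧ (σ.pinDistAt k).Z = σ.Z ∧ (σ.pinDistAt k).Λ = σ.Λ ∧
    (σ.pinDistAt k).OmT = σ.OmT ∧ (σ.pinDistAt k).ΩppT2 = σ.ΩppT2 ∧ (σ.pinDistAt k).Xhalf = σ.Xhalf ∧ (σ.pinDistAt k).XH = σ.XH ∧ (σ.pinDistAt k).XΩ4 = σ.XΩ4 ∧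
    (σ.pinDistAt k).boxOf = σ.boxOf ∧ (σ.pinDistAt k).β = σ.β ∧ (σ.pinDistAt k).L₀ = σ.L₀ ∧ (σ.pinDistAt k).δ = σ.δ ∧ (σ.pinDistAt k).B₃ = σ.B₃ ∧ (σ.pinDistAt k).B₅ = σ.B₅ ∧
    (σ.pinDistAt k).M = σ.M ∧ (σ.pinDistAt k).O1 = σ.O1 ∧ (σ.pinDistAt k).dev0 = σ.dev0 ∧ (σ.pinDistAt k).devV'' = σ.devV'' ∧ (σ.pinDistAt k).dev97 = σ.dev97 :=
  ⟨rfl, HEq.rfl, rfl, rfl, rfl, rfl, rfl, rfl, rfl, rfl, rfl, rfl, rfl, rfl, rfl, rfl, rfl, rfl, rfl, rfl, rfl, rfl, rfl, rfl, rfl, rfl, rfl⟩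

/-- The distance pin commutes with the term, levels, cubes, `Z″`, χ′ and `dev0` pins (`rfl`: disjoint fields; it reads only `Λ` and `k`). [cite: Balaban1989LargeFieldI, (1.89) p.198 (bookkeeping)] -/
theorem pinDistAt_comm {D : ℕ → Set (Set (Site (F.P K) 0))} {k' : ℕ} (s : B14.Eq218Concrete.Seq D k') (M Nm N₀ N₀' Nm' : ℕ) (S : Set (Site (F.P K) 0))
    (enl : ℕ → ℕ → Set (Site (F.P K) 0) → Set (Site (F.P K) 0)) (δ' : ℝ) (ν : Stage7Numerics) :
    (σ.pinDistAt k).pinTerm s = (σ.pinTerm s).pinDistAt k ∧ (σ.pinDistAt k).pinLevels M Nm N₀ = (σ.pinLevels M Nm N₀).pinDistAt k ∧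
    (σ.pinDistAt k).pinCubes S = (σ.pinCubes S).pinDistAt k ∧ (σ.pinDistAt k).pinZpp s N₀' Nm' enl = (σ.pinZpp s N₀' Nm' enl).pinDistAt k ∧
    (σ.pinDistAt k).pinChi182 δ' = (σ.pinChi182 δ').pinDistAt k ∧ (σ.pinDistAt k).pinDev0 ν = (σ.pinDev0 ν).pinDistAt k := ⟨rfl, rfl, rfl, rfl, rfl, rfl⟩

/-- **MODULES 4 ∕ 11 ∕ 14's INPUT `hdist : ∀ p, 0 ≤ dist p` IS A THEOREM at the distance pin.** [cite: Balaban1989LargeFieldI, (1.80) p.195 (bookkeeping)] -/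
theorem hdist_pinDistAt : ∀ p, 0 ≤ (σ.pinDistAt k).dist p := fun p => distOfRecord_nonneg σ.Λ k p

open B15Claim189PinsOfHistory (D189OfHist)
open B15Ineq180PinAtRecord (U0OfRecord)
open B15 (Ineq180)
open GaugeGroup (dist1)
open GaugeField (plaqHol)

/-- **(1.80) AT THE FULLY-LETTERED PIN READS OBJECTS OF RECORD ONLY** (`Iff.rfl`): at `D189OfHist ν P ((σ.pinDistAt σ.k).pinDev0 ν) g` the displayed (1.80) is
`|U_{k,Z}(V_Λ)(∂q) − 1| < 2ε_kη_k² + O(1)B₃B₅M⁵ e^{−δ·dist(q, Λ)} ε_kη_k²` with `U₀ = U_{k,Z}(V_Λ)` of record (module 8), `ε_k = epsOfRecord ν g k`, `η_k` of the torus, `dist(q, Λ)` OF RECORD (k-block units)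
— print's constants `B₃, B₅, M, δ, O(1)` the only residual numbers. [cite: Balaban1989LargeFieldI, (1.79)–(1.80) p.195] -/
theorem ineq180_D189OfHist_pinDist_iff (ν : Stage7Numerics) (P : B12.RunParams) (σ : Sit189 F N P.K) (g : ℕ → ℝ)
    (U : B15DeterminingSets.MSField (F.P P.K) (SU N) × ((j : ℕ) → VecField (F.P P.K) j σ.𝔤)) (q : Plaq (F.P P.K) 0) :
    Ineq180 ((D189OfHist ν P ((σ.pinDistAt σ.k).pinDev0 ν) g).dev0 U q) (epsOfRecord ν g σ.k) ((F.P P.K).eta σ.k) σ.B₃ σ.B₅ σ.M σ.δ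
        ((D189OfHist ν P ((σ.pinDistAt σ.k).pinDev0 ν) g).dist q) σ.O1 ↔
      dist1 (plaqHol (U0OfRecord (bgOfRecord (avOfRecord F N P.K) {U | PlaqSmall (ν.εreg * (F.P P.K).eta σ.k ^ 2) U}) ν.M₁ σ.Z σ.Λ σ.k (U.1 σ.k)) q)
        < 2 * epsOfRecord ν g σ.k * (F.P P.K).eta σ.k ^ 2
          + σ.O1 * σ.B₃ * σ.B₅ * σ.M ^ 5 * Real.exp (-σ.δ * ((distToSet σ.Λ q.src : ℝ) / ((F.P P.K).L : ℝ) ^ σ.k)) * epsOfRecord ν g σ.k * (F.P P.K).eta σ.k ^ 2 :=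
  Iff.rfl

end DistPin

section GeomDisplay

open B15 (Ineq180)
open B15.BasicStep (Claim189)
open B15.PrelimIntegrations (Ineq191 Ineq195)
open B15Chi124DetSets (E124)
open B15DeterminingSets (MSField)
open B15Claim189Assembly (Setting189 new189 chiPP dom half)
open B15Claim189PinsOfHistory (D189OfHist sitOfHist claim189_sitOfHist_N0Z_of_flow)
open B15Claim189PrintedConditions (omegaOfChain)
open B15Claim189N0OfRecord (N0OfSeq)
open GaugeGroup (dist1)
open GaugeField (plaqHol)

variable {F : T4Family} {N : ℕ} [NeZero N] {ν : Stage7Numerics} {A₁ : ℝ} {M : ℕ} (Nm : ℕ) (P : B12.RunParams) (σ : Sit189 F N P.K) {g : ℕ → ℝ} {k' : ℕ}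
  (s : SeqOfRecord F ν M g P.K k') (p₁ : ℕ)

/-- **(1.89) WITH THE GEOMETRIC LETTERS PINNED (cubes AND distance) AND `N₀`, `Z″` OF THE HISTORY — `hZk`, `hbox` AND `hdist` ALL DISCHARGED** (window-free form, at
`σ' := (σ.pinCubes ((Ω″^∼_{h+1})ᶜ ∩ Ω_h)).pinDistAt k′`): of the located geometry only the shell bound `4(m − k₀)M ≤ dist(p, Λ)` remains — now a statement about OBJECTS (the term's chain, the
letter `Λ`, `dist(·, Λ)` of record), awaiting the (2.1)–(2.3) separation law of the index of record. [cite: Balaban1989LargeFieldI, (1.89) p.198, (1.10)–(1.11) p.179, (1.80) p.195, (1.88) p.198, pp.199–200; Balaban1988Convergent, (2.1) p.254, (2.17) p.257] -/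
theorem claim189_sitOfHist_geom_N0Z_of_flow (hsh : 0 < σ.sh) (enl : ℕ → ℕ → Set (Site (F.P P.K) 0) → Set (Site (F.P P.K) 0))
    (henl : ∀ n j (S : Set (Site (F.P P.K) 0)), S ⊆ enl n j S)
    {D : Setting189 (F.P P.K) (SU N) (MSField (F.P P.K) (SU N) × ((j : ℕ) → VecField (F.P P.K) j (EuclideanSpace ℝ (Fin (N ^ 2 - 1))))) (Pt (F.P P.K).d)}
    (hD : D = D189OfHist ν P (sitOfHist ν A₁ M Nm P (((σ.pinCubes (σ.OmTᶜ ∩ omegaOfChain s (k' - Nm))).pinDistAt k').pinZpp s (N0OfSeq (F.P P.K).L ν.r g k') Nm enl) g s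
      (N0OfSeq (F.P P.K).L ν.r g k') p₁) g)
    (hlog : 1 < (Real.log (g k' ^ 2)⁻¹) ^ ν.r) (hNN : N0OfSeq (F.P P.K).L ν.r g k' ≤ Nm) (hNk : N0OfSeq (F.P P.K).L ν.r g k' ≤ k')
    (hβ0 : 0 ≤ σ.β) (hβ : σ.β ≤ 1 / 4) (hL₀ : 2 ≤ σ.L₀) (hL₀L : σ.L₀ ^ 2 ≤ ((F.P P.K).L : ℝ))
    (hB : 0 ≤ σ.O1 * σ.B₃ * σ.B₅) (hδ : 0 ≤ σ.δ)
    (hN₀ : (2 + (121 / 120) ^ 2 * (σ.O1 * σ.B₃ * σ.B₅ * (M : ℝ) ^ 5)) * ((σ.L₀ ^ 2) ^ (N0OfSeq (F.P P.K).L ν.r g k' - 1))⁻¹ ≤ 1 / 4)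
    (hMl : (121 / 120) ^ 2 * (σ.O1 * σ.B₃ * σ.B₅ * (M : ℝ) ^ 5) * Real.exp (-(4 * σ.δ * (M : ℝ))) ≤ 1 / 12)
    (hε0 : ∀ i, k' - Nm ≤ i → i ≤ k' → 0 ≤ epsOfRecord ν g i) (hε1 : ∀ i, k' - Nm ≤ i → i ≤ k' → epsOfRecord ν g i ≤ 1 / 10)
    {β₀ : ℝ} (hβ₀0 : 0 ≤ β₀) (hβ₀ : β₀ ≤ 1 / 2)
    (hflow : ∀ j, k' - Nm ≤ j → j < k' → epsOfRecord ν g k' ≤ (1 + β₀) * Real.sqrt ((k' - j : ℕ) : ℝ) * epsOfRecord ν g j)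
    (hgeom : ∀ m, D.k₀ < m → m < D.k → ∀ p ∈ plaqsOf (D.Ω m \ D.Ω (m + 1)), 4 * ((m : ℝ) - D.k₀) * D.M ≤ D.dist p)
    (L91h : ∀ U, new189 D U → ∀ p ∈ plaqsOf (half D),
      Ineq191 (dist1 (plaqHol (D.Upp U) p)) (D.devV'' U p) D.α ((D.L ^ D.h)⁻¹) (D.ε D.h) (E124 D.ε D.L D.η D.k D.h))
    (L95 : ∀ U, new189 D U → ∀ p ∈ plaqsOf (half D),
      Ineq195 (D.devV'' U p) (dist1 (plaqHol (D.Uhalf U (D.boxOf p)) p)) D.α ((D.L ^ D.h)⁻¹) (D.ε D.h) (E124 D.ε D.L D.η D.k D.h))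
    (L91 : ∀ U, new189 D U → ∀ j, D.h ≤ j → j ≤ D.k → ∀ p ∈ plaqsOf (dom D j),
      Ineq191 (dist1 (plaqHol (D.Upp U) p)) (D.dev97 U p) D.α ((D.L ^ j)⁻¹) (D.ε j) (E124 D.ε D.L D.η D.k j))
    (L97 : ∀ U, new189 D U → ∀ j, D.h ≤ j → j ≤ D.k → ∀ p ∈ plaqsOf (dom D j),
      Ineq191 (D.dev97 U p) (D.dev0 U p) D.α ((D.L ^ j)⁻¹) (D.ε j) (E124 D.ε D.L D.η D.k j))
    (L80 : ∀ U, new189 D U → ∀ j, D.h ≤ j → j ≤ D.k → ∀ p ∈ plaqsOf (dom D j),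
      Ineq180 (D.dev0 U p) (D.ε D.k) D.η D.B₃ D.B₅ D.M D.δ (D.dist p) D.O1) :
    Claim189 (new189 D) (chiPP D) :=
  claim189_sitOfHist_N0Z_of_flow Nm P ((σ.pinCubes (σ.OmTᶜ ∩ omegaOfChain s (k' - Nm))).pinDistAt k') s p₁ enl henl hD hlog hNN hNk hβ0 hβ hL₀ hL₀L hB hδ
    (hdist_pinDistAt _ k') hN₀ hMl hε0 hε1 hβ₀0 hβ₀ hflow hgeom
    (hbox_sitOfHist_pinCubes P ((σ.pinDistAt k').pinZpp s (N0OfSeq (F.P P.K).L ν.r g k') Nm enl) g Nm s _ p₁ hsh (by subst hD; rfl)) L91h L95 L91 L97 L80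

end GeomDisplay

end B15Claim189CubePin

end Literature.MathematicalPhysics.QuantumFieldTheory.Balaban1983to89

end
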